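import Literature.NumberTheory.GaloisRepresentations.QuadraticArtinIndicator
import Literature.NumberTheory.Automorphic.IdeleClassGroupProofs
import Literature.NumberTheory.Automorphic.AdelicSecondCountable
import HarnessLib

/-!
# The quadratic Artin character `ω_{K(√d)/K}` on the ideles is measurable and non-trivial on the
# norm-one ideles

Topic `NumberTheory/GaloisRepresentations` (idelic class field theory, quadratic case); namespace
`Literature.NumberTheory.GaloisRepresentations`. THEOREMS ONLY (no definition, no instance, no
notation, no named fact, no `sorry`). Complements to `QuadraticArtinIndicator`
(`quadraticArtinIndicator K d : 𝕀_K → ℤ∕2`, the indicator of `X ∉ Kˣ · N(𝕀_{K(√d)})`, i.e. of the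
complement of ★ `principalIdeles K ⊔ normIdeles K d`, index `2` for `d` a non-square by
★ `OMeara65.normIdeles_index_eq_two_holds` [Omeara1963, §65D Prop. 65:21]): the measure-theoretic
facts an integral over `𝕀_K` against the quadratic character `ω = (−1)^{[·]}` needs.

* **`measurableSet_normIdeles`** — `N(𝕀_E) = normIdeles K d` (the idèles that are local norms at
  every place, [Omeara1963, §65A Example 65:2]) is a Borel set of `𝕀_K`: each local condition
  "`i_v ∈ {x² − d y²}`" is the preimage under the continuous coordinate map of a `σ`-COMPACT subset
  of `K_v` (the continuous image of `K_v × K_v`), hence a countable union of closed sets, and there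
  are countably many places;
* **`measurableSet_principalIdeles_sup_normIdeles`** — `Kˣ · N(𝕀_E) = ⋃_{k ∈ Kˣ} k · N(𝕀_E)` is
  Borel (countable union);
* `posRealIdele_mem_normIdeles` — Weil's positive real ideles `z(ℝ_{>0})` are norm idèles
  (squares at the infinite places, `1` at the finite places);
* **`exists_ideleNorm_eq_one_not_mem_sup_normIdeles`** — for `d` a non-square there is a NORM-ONE
  idele outside `Kˣ · N(𝕀_E)` (index `2` and `𝕀_K = 𝕀_K¹ · z(ℝ_{>0})`,
  ★ `exists_normOneIdeles_mul_posRealIdele`) — the witness `y₀` of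
  ★ `Automorphic.integrableOn_and_setIntegral_tateTruncated_twisted` for `χ = ω_{E/K}`;
* `neg_one_pow_quadraticArtinIndicator_of_mem` ∕ `_of_not_mem`, **`measurable_neg_one_pow_quadraticArtinIndicator`**
  — `ω = (−1)^{[·]} : 𝕀_K → ℂ` is `1` on `Kˣ N(𝕀_E)`, `−1` off it, and Borel measurable.

Cell `hodgecm-mathlib`, ENGINE T1 LAW 5 ((L5-i) piece C ∕ (L5-iii-c): the `ω_{E/F}`-twisted
terms (c) of [Rogawski1990, Props. 7.2.2, 7.3.1, 7.3.2] after the index-two character sum). HC_CM is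
proved only modulo the 7 printed citations until rung 0 closes — nothing here bears on a summit
statement.

## References
* [Omeara1963] O. T. O'Meara, *Introduction to Quadratic Forms* (1963), §65A Example 65:2, §65D
  Prop. 65:21, §71 Thm. 71:19.
* [CasselsFrohlichANT1967] Cassels–Fröhlich (eds.), *Algebraic Number Theory* (1967), Ch. VII
  §5.1 (B), Ch. II §16.
* [Rogawski1990] J. D. Rogawski, *Automorphic Representations of Unitary Groups in Three
  Variables* (1990), §7.2, proof of Prop. 7.2.2 (the characters of `F^* N I_E ∖ I_F`).
-/

set_option autoImplicit false

noncomputable section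

open NumberField IsDedekindDomain Set Topology
open scoped Classical NNReal Pointwise

namespace Literature.NumberTheory.GaloisRepresentations

open Literature.NumberTheory.QuadraticForms Literature.NumberTheory.Automorphic

variable {K : Type} [Field K] [NumberField K]

/-! ### `σ`-compactness of the local norm sets -/

/-- The preimage of a `σ`-compact subset of a Hausdorff space under a continuous map is Borel
(a countable union of closed sets). [folklore] -/
private theorem measurableSet_preimage_of_isSigmaCompact {X Y : Type*} [TopologicalSpace X]
    [MeasurableSpace X] [OpensMeasurableSpace X] [TopologicalSpace Y] [T2Space Y] {f : X → Y}
    (hf : Continuous f) {S : Set Y} (hS : IsSigmaCompact S) : MeasurableSet (f ⁻¹' S) := by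
  obtain ⟨C, hC, rfl⟩ := hS
  rw [preimage_iUnion]
  exact MeasurableSet.iUnion fun n => ((hC n).isClosed.preimage hf).measurableSet

/-- The set of values `x² − a y²` of a `σ`-compact topological ring is `σ`-compact (continuous image
of `L × L`). [folklore] -/
private theorem isSigmaCompact_setOf_exists_sq_sub_mul_sq {L : Type*} [CommRing L]
    [TopologicalSpace L] [IsTopologicalRing L] [SigmaCompactSpace L] (a : L) :
    IsSigmaCompact {t : L | ∃ x y : L, x ^ 2 - a * y ^ 2 = t} := by
  have h : {t : L | ∃ x y : L, x ^ 2 - a * y ^ 2 = t} =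
      range fun p : L × L => p.1 ^ 2 - a * p.2 ^ 2 := by
    ext t
    simp only [mem_setOf_eq, mem_range, Prod.exists]
  rw [h]
  exact isSigmaCompact_range (by fun_prop)

omit [NumberField K] in
/-- A completion of `K` at an infinite place is `σ`-compact (it is homeomorphic to `ℝ` or `ℂ`).
[folklore] -/
private theorem sigmaCompactSpace_completion (w : InfinitePlace K) : SigmaCompactSpace w.Completion := by
  by_cases hw : w.IsReal
  · haveI := (InfinitePlace.Completion.isometryEquivRealOfIsReal hw).toHomeomorph.secondCountableTopology
    infer_instance
  · haveI := (InfinitePlace.Completion.isometryEquivComplexOfIsComplex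
      (InfinitePlace.not_isReal_iff_isComplex.1 hw)).toHomeomorph.secondCountableTopology
    infer_instance

/-! ### Measurability of `N(𝕀_E)` and of `Kˣ · N(𝕀_E)` -/

variable [MeasurableSpace (ideleGroup K)] [BorelSpace (ideleGroup K)]

/-- **`normIdeles K d` is a Borel subset of `𝕀_K`.** [cite: Omeara1963, §65A Example 65:2] -/
theorem measurableSet_normIdeles (d : K) : MeasurableSet (normIdeles K d : Set (ideleGroup K)) := by
  haveI : Countable (HeightOneSpectrum (𝓞 K)) := countable_heightOneSpectrum K
  have hset : (normIdeles K d : Set (ideleGroup K)) =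
      (⋂ v : HeightOneSpectrum (𝓞 K), (fun i : ideleGroup K => (i : AdeleRing (𝓞 K) K).2 v) ⁻¹'
          {t : v.adicCompletion K | ∃ x y : v.adicCompletion K,
            x ^ 2 - algebraMap K (v.adicCompletion K) d * y ^ 2 = t}) ∩
        ⋂ w : InfinitePlace K, (fun i : ideleGroup K => (i : AdeleRing (𝓞 K) K).1 w) ⁻¹'
          {t : w.Completion | ∃ x y : w.Completion,
            x ^ 2 - algebraMap K w.Completion d * y ^ 2 = t} := by
    ext i
    simp only [SetLike.mem_coe, mem_normIdeles_iff, mem_inter_iff, mem_iInter, mem_preimage,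
      mem_setOf_eq]
    rfl
  rw [hset]
  refine MeasurableSet.inter (MeasurableSet.iInter fun v => ?_) (MeasurableSet.iInter fun w => ?_)
  · haveI := secondCountableTopology_adicCompletion K v
    have hc : Continuous fun i : ideleGroup K => (i : AdeleRing (𝓞 K) K).2 v :=
      (AdelicGroupData.continuous_adeleEval K v).comp Units.continuous_val
    exact measurableSet_preimage_of_isSigmaCompact hc (isSigmaCompact_setOf_exists_sq_sub_mul_sq _)
  · haveI := sigmaCompactSpace_completion w
    have hc : Continuous fun i : ideleGroup K => (i : AdeleRing (𝓞 K) K).1 w :=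
      (continuous_apply w).comp (continuous_fst.comp Units.continuous_val)
    exact measurableSet_preimage_of_isSigmaCompact hc (isSigmaCompact_setOf_exists_sq_sub_mul_sq _)

omit [MeasurableSpace (ideleGroup K)] [BorelSpace (ideleGroup K)] in
/-- `Kˣ · N(𝕀_E)` as a union of translates: `↑(principalIdeles K ⊔ normIdeles K d) =
⋃_{k ∈ Kˣ} k · normIdeles K d` (`𝕀_K` is commutative). [cite: CasselsFrohlichANT1967, Ch. VII §5.1 (B)] -/
theorem coe_principalIdeles_sup_normIdeles_eq_iUnion (d : K) :
    (↑(principalIdeles K ⊔ normIdeles K d) : Set (ideleGroup K)) =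
      ⋃ k : principalIdeles K, (k : ideleGroup K) • (normIdeles K d : Set (ideleGroup K)) := by
  ext x
  simp only [SetLike.mem_coe, mem_iUnion]
  constructor
  · intro hx
    obtain ⟨y, hy, z, hz, rfl⟩ := Subgroup.mem_sup.1 hx
    exact ⟨⟨y, hy⟩, smul_mem_smul_set hz⟩
  · rintro ⟨k, hk⟩
    obtain ⟨z, hz, rfl⟩ := mem_smul_set.1 hk
    exact Subgroup.mem_sup.2 ⟨k, k.2, z, hz, rfl⟩

/-- **`Kˣ · N(𝕀_E)` is a Borel subset of `𝕀_K`** (countable union of translates of the Borel set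
`N(𝕀_E)`). [cite: CasselsFrohlichANT1967, Ch. VII §5.1 (B)] -/
theorem measurableSet_principalIdeles_sup_normIdeles (d : K) :
    MeasurableSet (↑(principalIdeles K ⊔ normIdeles K d) : Set (ideleGroup K)) := by
  haveI := secondCountableTopology_ideleGroup K
  haveI : MeasurableMul (ideleGroup K) := inferInstance
  rw [coe_principalIdeles_sup_normIdeles_eq_iUnion]
  exact MeasurableSet.iUnion fun k => (measurableSet_normIdeles d).const_smul (k : ideleGroup K)

/-! ### A norm-one idele outside `Kˣ · N(𝕀_E)` -/

omit [MeasurableSpace (ideleGroup K)] [BorelSpace (ideleGroup K)] in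
/-- Weil's positive real ideles are norm idèles: at an infinite place `w` the coordinate of `z(r)`
is the square of that of `z(√r)`, at the finite places it is `1`. [cite: Omeara1963, §65A Example 65:2] -/
theorem posRealIdele_mem_normIdeles (d : K) (r : ℝ≥0ˣ) : posRealIdele K r ∈ normIdeles K d := by
  rw [mem_normIdeles_iff]
  refine ⟨fun v => ?_, fun w => ?_⟩
  · have h1 : ideleFiniteComponent K v (posRealIdele K r) = 1 := by
      ext
      rw [val_ideleFiniteComponent, posRealIdele_snd]
      rfl
    rw [h1]
    exact one_mem _
  · refine ⟨realToInfiniteAdele K (Real.sqrt r) w, 0, ?_⟩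
    have hsq : realToInfiniteAdele K (r : ℝ≥0) =
        realToInfiniteAdele K (Real.sqrt r) * realToInfiniteAdele K (Real.sqrt r) := by
      rw [← map_mul, Real.mul_self_sqrt (NNReal.coe_nonneg _)]
    rw [val_ideleInfiniteComponent, posRealIdele_fst, zero_pow two_ne_zero, mul_zero, sub_zero,
      sq, hsq]
    rfl

omit [MeasurableSpace (ideleGroup K)] [BorelSpace (ideleGroup K)] in
/-- **A norm-one idele outside the norm group.** For `d` a non-square, `Kˣ · N(𝕀_{K(√d)})` has
index `2` in `𝕀_K` [Omeara1963, Prop. 65:21]; any idele outside it, divided by its positive real part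
`z(r) ∈ N(𝕀_E)`, is a norm-one idele outside it. [cite: Omeara1963, §65D Prop. 65:21] -/
theorem exists_ideleNorm_eq_one_not_mem_sup_normIdeles {d : K} (hd : ¬ IsSquare d) :
    ∃ y₀ : ideleGroup K, IdeleClassGroup.ideleNorm K y₀ = 1 ∧
      y₀ ∉ principalIdeles K ⊔ normIdeles K d := by
  have hidx : (principalIdeles K ⊔ normIdeles K d).index = 2 :=
    OMeara65.normIdeles_index_eq_two_holds K d hd
  have hne : principalIdeles K ⊔ normIdeles K d ≠ ⊤ := by
    intro h
    rw [h, Subgroup.index_top] at hidx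
    exact absurd hidx (by norm_num)
  obtain ⟨x, hx⟩ : ∃ x : ideleGroup K, x ∉ principalIdeles K ⊔ normIdeles K d :=
    not_forall.1 fun h => hne (eq_top_iff.2 fun x _ => h x)
  obtain ⟨y, hy, r, rfl⟩ := exists_normOneIdeles_mul_posRealIdele K x
  refine ⟨y, mem_normOneIdeles.1 hy, fun hyH => hx ?_⟩
  exact Subgroup.mul_mem _ hyH (Subgroup.mem_sup_right (posRealIdele_mem_normIdeles d r))

/-! ### The quadratic character `ω = (−1)^{[·]}` -/

omit [MeasurableSpace (ideleGroup K)] [BorelSpace (ideleGroup K)] in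
/-- `ω(X) = 1` on `Kˣ · N(𝕀_E)`. [cite: Omeara1963, §71 Thm. 71:19] -/
theorem neg_one_pow_quadraticArtinIndicator_of_mem {d : K} {X : ideleGroup K}
    (hX : X ∈ principalIdeles K ⊔ normIdeles K d) :
    (-1 : ℂ) ^ (quadraticArtinIndicator K d X).val = 1 := by
  rw [quadraticArtinIndicator_eq_zero_iff.2 hX, ZMod.val_zero, pow_zero]

omit [MeasurableSpace (ideleGroup K)] [BorelSpace (ideleGroup K)] in
/-- `ω(X) = −1` off `Kˣ · N(𝕀_E)`. [cite: Omeara1963, §71 Thm. 71:19] -/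
theorem neg_one_pow_quadraticArtinIndicator_of_not_mem {d : K} {X : ideleGroup K}
    (hX : X ∉ principalIdeles K ⊔ normIdeles K d) :
    (-1 : ℂ) ^ (quadraticArtinIndicator K d X).val = -1 := by
  rw [quadraticArtinIndicator_eq_one_iff.2 hX, ZMod.val_one, pow_one]

/-- **`ω = (−1)^{[·]} : 𝕀_K → ℂ` is Borel measurable** (it is `1` on the Borel set `Kˣ · N(𝕀_E)` and
`−1` off it). [cite: Omeara1963, §71 Thm. 71:19] -/
theorem measurable_neg_one_pow_quadraticArtinIndicator (d : K) :
    Measurable fun X : ideleGroup K => (-1 : ℂ) ^ (quadraticArtinIndicator K d X).val := by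
  have h : (fun X : ideleGroup K => (-1 : ℂ) ^ (quadraticArtinIndicator K d X).val) =
      fun X => if X ∈ (↑(principalIdeles K ⊔ normIdeles K d) : Set (ideleGroup K)) then (1 : ℂ)
        else -1 := by
    funext X
    by_cases hX : X ∈ principalIdeles K ⊔ normIdeles K d
    · rw [neg_one_pow_quadraticArtinIndicator_of_mem hX, if_pos (by exact hX)]
    · rw [neg_one_pow_quadraticArtinIndicator_of_not_mem hX, if_neg (by exact hX)]
  rw [h]
  exact Measurable.ite (measurableSet_principalIdeles_sup_normIdeles d) measurable_const
    measurable_const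

end Literature.NumberTheory.GaloisRepresentations
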